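import Mathlib
import Literature.Computability.AlgebraicComplexity.PrattTrapezoidVal
import Literature.Computability.AlgebraicComplexity.PrattTrapezoidValBounds
import Summits.MatrixMultiplication.MatrixMultiplication.Theorems.SoloBlindPrattValEventually

/-!
# Solo-blind seat, s42 (third file): Pratt's integer `Val(N)` is superlinear

Pratt (arXiv:2309.03878, Def. 4.2) calls `(A, B, C)`, `A, B, C ⊆ {0, …, N}`, an equilateral
trapezoid-free triple if for all fixed `a', b', c'` each of the systems
`N = a'+b+c = a+b'+c`, `N = a'+b+c = a+b+c'`, `N = a+b'+c = a+b+c'` has at most one solution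
`(a, b, c) ∈ A × B × C`, and writes `Val(N)` for the maximum number of solutions of `a+b+c = N`
over such triples; `Val(N)` is the largest "line configuration" in the triangle `Δ_{N+1}` with no
axis-parallel equilateral triangle or trapezoid, and (Prop. 4.13) a lower bound for the largest
skew-corner-free subset of `Δ_{N+1}`, for which "the best lower bound that we know … is `Ω(n)` …
it is not hard to improve this to `3n/2`" (loc. cit. §4.1, p. 11).

Translating the third set by `−N`, the trapezoid condition is literally the tree's
`IsEquilateralTrapezoidFree (G := ℤ) A B (C − N)`.  In this def-free form we certify

* `soloVal_card_zeroSumTriples_zmod_le_one_add` — in `ℤ/n'`, the zero-sum triples of any triple of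
  sets number at most `1 + T₁ + T₂`, `T_s` = triples with least-residue sum `s·n'`;
* `soloVal_integerVal_eventually` — **for every `M` and all large `N` there is an equilateral
  trapezoid-free triple in `{0, …, N}` with at least `M·N` solutions of `a + b + c = N`**, i.e.
  `Val(N)/N → ∞` (Prop. 4.3(2) `1 + 2·Val(2n) ≥ Val(ℤ_n)` made explicit, fed by
  `soloVal_prattVal_zmod_eventually` of `SoloBlindPrattValEventually`).

By Pratt's Prop. 4.13 (pen) the largest skew-corner-free subset of `Δ_N` is therefore superlinear
in `N` (pen rate `N · exp(((2/3) ln 2 − o(1)) ln N / ln ln N)`, SHARPEST §3 Q12).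

References: [Pratt2024] K. Pratt, arXiv:2309.03878, Def. 4.2, Prop. 4.3, Prop. 4.13, §4.1.
-/

set_option linter.dupNamespace false

namespace Summit.MatrixMultiplication.MatrixMultiplication.Theorems

open Finset Literature.Computability.AlgebraicComplexity

/-- In `ℤ/n'ℤ` a zero-sum triple has least-residue sum `0`, `n'` or `2n'`, and at most one triple
has residue sum `0`; hence `#zeroSumTriples ≤ 1 + T₁ + T₂`. -/
theorem soloVal_card_zeroSumTriples_zmod_le_one_add {n' : ℕ} [NeZero n']
    (A B C : Finset (ZMod n')) :
    #(zeroSumTriples A B C) ≤ 1 +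
      (#((A ×ˢ B ×ˢ C).filter fun t => t.1.val + t.2.1.val + t.2.2.val = 1 * n') +
       #((A ×ˢ B ×ˢ C).filter fun t => t.1.val + t.2.1.val + t.2.2.val = 2 * n')) := by
  have hn' : 0 < n' := Nat.pos_of_ne_zero (NeZero.ne n')
  have hsub : zeroSumTriples A B C ⊆
      ((A ×ˢ B ×ˢ C).filter fun t => t.1.val + t.2.1.val + t.2.2.val = 0) ∪
      (((A ×ˢ B ×ˢ C).filter fun t => t.1.val + t.2.1.val + t.2.2.val = 1 * n') ∪
       ((A ×ˢ B ×ˢ C).filter fun t => t.1.val + t.2.1.val + t.2.2.val = 2 * n')) := by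
    intro t ht
    rw [mem_zeroSumTriples] at ht
    obtain ⟨hmem, hsum⟩ := ht
    have hmem' : t ∈ A ×ˢ B ×ˢ C := by simp [mem_product, hmem.1, hmem.2.1, hmem.2.2]
    have hdvd : n' ∣ t.1.val + t.2.1.val + t.2.2.val := by
      rw [← CharP.cast_eq_zero_iff (ZMod n') n']
      push_cast
      simpa [ZMod.natCast_zmod_val] using hsum
    have hlt : t.1.val + t.2.1.val + t.2.2.val < 3 * n' := by
      have := t.1.val_lt; have := t.2.1.val_lt; have := t.2.2.val_lt; omega
    obtain ⟨q, hq⟩ := hdvd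
    simp only [mem_union, mem_filter, hmem', true_and]
    rcases q with _ | _ | _ | q
    · left; omega
    · right; left; omega
    · right; right; omega
    · exfalso
      have : 3 * n' ≤ n' * (q + 1 + 1 + 1) := by nlinarith
      omega
  have h0 : #((A ×ˢ B ×ˢ C).filter fun t => t.1.val + t.2.1.val + t.2.2.val = 0) ≤ 1 := by
    refine Finset.card_le_one.2 fun t ht t' ht' => ?_
    simp only [mem_filter] at ht ht'
    have e1 : t.1.val = t'.1.val := by omega
    have e2 : t.2.1.val = t'.2.1.val := by omega
    have e3 : t.2.2.val = t'.2.2.val := by omega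
    exact Prod.ext (ZMod.val_injective n' e1)
      (Prod.ext (ZMod.val_injective n' e2) (ZMod.val_injective n' e3))
  calc #(zeroSumTriples A B C) ≤ _ := card_le_card hsub
    _ ≤ 1 + (#((A ×ˢ B ×ˢ C).filter fun t => t.1.val + t.2.1.val + t.2.2.val = 1 * n') +
          #((A ×ˢ B ×ˢ C).filter fun t => t.1.val + t.2.1.val + t.2.2.val = 2 * n')) :=
        (card_union_le _ _).trans (Nat.add_le_add h0 (card_union_le _ _))

/-- The integer lift of one residue class of solutions.  For `s ∈ {1, 2}`, `2n ≤ N`, and sets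
`A₀, B₀, C₀ ⊆ ℤ/n`, put `A = A₀ + (N − s·n)`, `B = B₀`, `C = C₀` (least residues, in `ℤ`): all three
lie in `[0, N]`, `(A, B, C − N)` is equilateral trapezoid-free if `(A₀, B₀, C₀)` is, and the
solutions of `a + b + c = N` are at least the triples of `A₀ × B₀ × C₀` with residue sum `s·n`. -/
theorem soloVal_integer_lift {n N s : ℕ} [NeZero n] (h2 : 2 * n ≤ N) (hs1 : 1 ≤ s) (hs2 : s ≤ 2)
    {A₀ B₀ C₀ : Finset (ZMod n)} (hE : IsEquilateralTrapezoidFree A₀ B₀ C₀) :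
    ∃ A B C : Finset ℤ, (∀ a ∈ A, 0 ≤ a ∧ a ≤ N) ∧ (∀ b ∈ B, 0 ≤ b ∧ b ≤ N) ∧
      (∀ c ∈ C, 0 ≤ c ∧ c ≤ N) ∧
      IsEquilateralTrapezoidFree A B (C.image fun c => c - (N : ℤ)) ∧
      #((A₀ ×ˢ B₀ ×ˢ C₀).filter fun t => t.1.val + t.2.1.val + t.2.2.val = s * n) ≤
        #((A ×ˢ B ×ˢ C).filter fun t => t.1 + t.2.1 + t.2.2 = (N : ℤ)) := by
  have hn : 0 < n := Nat.pos_of_ne_zero (NeZero.ne n)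
  have hsn : n ≤ s * n := Nat.le_mul_of_pos_left _ hs1
  have hs2n : s * n ≤ 2 * n := Nat.mul_le_mul_right _ hs2
  -- the maps
  let f : ZMod n → ℤ := fun a => (a.val : ℤ) + ((N : ℤ) - s * n)
  let g : ZMod n → ℤ := fun b => (b.val : ℤ)
  refine ⟨A₀.image f, B₀.image g, C₀.image g, ?_, ?_, ?_, ?_, ?_⟩
  · intro a ha
    obtain ⟨a₀, _, rfl⟩ := mem_image.1 ha
    have := a₀.val_lt
    constructor <;> · simp only [f]; omega
  · intro b hb
    obtain ⟨b₀, _, rfl⟩ := mem_image.1 hb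
    have := b₀.val_lt
    constructor <;> · simp only [g]; omega
  · intro c hc
    obtain ⟨c₀, _, rfl⟩ := mem_image.1 hc
    have := c₀.val_lt
    constructor <;> · simp only [g]; omega
  · rw [Finset.image_image]
    refine soloVal_etf_lift hE f g ((fun c : ℤ => c - (N : ℤ)) ∘ g) ?_
    intro a _ b _ c _ habc
    simp only [f, g, Function.comp] at habc
    have hv : a.val + b.val + c.val = s * n := by
      have := a.val_lt; have := b.val_lt; have := c.val_lt
      omega
    have : ((a.val + b.val + c.val : ℕ) : ZMod n) = ((s * n : ℕ) : ZMod n) := by rw [hv]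
    simpa [ZMod.natCast_zmod_val, ZMod.natCast_self] using this
  · refine Finset.card_le_card_of_injOn (fun t => (f t.1, g t.2.1, g t.2.2)) ?_ ?_
    · intro t ht
      simp only [coe_filter, Set.mem_setOf_eq, mem_product] at ht
      obtain ⟨⟨ha, hb, hc⟩, hsum⟩ := ht
      simp only [coe_filter, Set.mem_setOf_eq, mem_product, mem_image]
      refine ⟨⟨⟨_, ha, rfl⟩, ⟨_, hb, rfl⟩, ⟨_, hc, rfl⟩⟩, ?_⟩
      simp only [f, g]
      have hsum' : ((t.1.val + t.2.1.val + t.2.2.val : ℕ) : ℤ) = ((s * n : ℕ) : ℤ) := by rw [hsum]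
      push_cast at hsum' ⊢
      linarith
    · intro t _ t' _ htt
      simp only [Prod.mk.injEq, f, g] at htt
      obtain ⟨e1, e2, e3⟩ := htt
      refine Prod.ext (ZMod.val_injective n (by omega))
        (Prod.ext (ZMod.val_injective n (by omega)) (ZMod.val_injective n (by omega)))

/-- **Pratt's `Val(N)` is superlinear** (def-free form of Def. 4.2 of arXiv:2309.03878, third set
translated by `−N`): for every `M` there is `N₀` such that for all `N ≥ N₀` some equilateral
trapezoid-free triple `A, B, C ⊆ {0, …, N}` has at least `M·N` solutions of `a + b + c = N`. -/
theorem soloVal_integerVal_eventually (M : ℕ) :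
    ∃ N₀ : ℕ, ∀ N : ℕ, N₀ ≤ N →
      ∃ A B C : Finset ℤ, (∀ a ∈ A, 0 ≤ a ∧ a ≤ N) ∧ (∀ b ∈ B, 0 ≤ b ∧ b ≤ N) ∧
        (∀ c ∈ C, 0 ≤ c ∧ c ≤ N) ∧
        IsEquilateralTrapezoidFree A B (C.image fun c => c - (N : ℤ)) ∧
        M * N ≤ #((A ×ˢ B ×ˢ C).filter fun t => t.1 + t.2.1 + t.2.2 = (N : ℤ)) := by
  obtain ⟨N₁, hN₁⟩ := soloVal_prattVal_zmod_eventually (6 * M + 1)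
  refine ⟨2 * N₁ + 2, fun N hN => ?_⟩
  -- `n = ⌊N/2⌋ = n'' + 1` with `n'' ≥ N₁`
  obtain ⟨n'', hn''⟩ : ∃ n'', N / 2 = n'' + 1 := ⟨N / 2 - 1, by omega⟩
  have hN2 : 2 * (n'' + 1) ≤ N := by omega
  have hN3 : N ≤ 2 * (n'' + 1) + 1 := by omega
  have hV := hN₁ n'' (by omega)
  -- an optimal trapezoid-free triple in `ℤ/(n''+1)`
  obtain ⟨A₀, B₀, C₀, hE, hT⟩ := exists_prattVal_eq (G := ZMod (n'' + 1))
  have hdec := soloVal_card_zeroSumTriples_zmod_le_one_add A₀ B₀ C₀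
  rw [hT] at hdec
  -- the larger of the two residue classes carries at least `(Val − 1)/2 ≥ M·N` solutions
  by_cases h12 : #((A₀ ×ˢ B₀ ×ˢ C₀).filter fun t => t.1.val + t.2.1.val + t.2.2.val = 2 * (n'' + 1))
      ≤ #((A₀ ×ˢ B₀ ×ˢ C₀).filter fun t => t.1.val + t.2.1.val + t.2.2.val = 1 * (n'' + 1))
  · obtain ⟨A, B, C, hA, hB, hC, hE', hcount⟩ :=
      soloVal_integer_lift (s := 1) hN2 le_rfl (by norm_num) hE
    refine ⟨A, B, C, hA, hB, hC, hE', le_trans ?_ hcount⟩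
    have : M * N ≤ M * (2 * (n'' + 1) + 1) := Nat.mul_le_mul_left _ hN3
    nlinarith
  · obtain ⟨A, B, C, hA, hB, hC, hE', hcount⟩ :=
      soloVal_integer_lift (s := 2) hN2 (by norm_num) le_rfl hE
    refine ⟨A, B, C, hA, hB, hC, hE', le_trans ?_ hcount⟩
    have : M * N ≤ M * (2 * (n'' + 1) + 1) := Nat.mul_le_mul_left _ hN3
    rw [not_le] at h12
    nlinarith

end Summit.MatrixMultiplication.MatrixMultiplication.Theorems
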